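import Summits.Ventures.PercRepro.C026TwoTimesCF

/-!
# THEOREM PROD-CF, the graph half (1): the six counts of a marked multigraph and their identities (p5, gen 16)

mine-3's product theorem for (CF) (`proofs/MINE3-PRODUCT.md` §2b, `MINE3-PRODUCT-LEANSHEET.md` §B) is
stated on a `k`-fold product of components. Here it is cut down to identities on ONE marked
multigraph (this file) and a dictionary for a 3-terminal gluing (`C026ProdCFGluingDict`), so that
the two-generator inequality `ProdCF.prodCF_two'` (`C026ProdCFCone`) composes (CF) over p6's
`IsGluing` (`C026ProdCFGluing`) — the `k`-fold version is then iteration.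

For a marked multigraph `G` with marks `a, b, c` and the closed cluster `D = Com_c(S̄)`:

* `Apart ω a b c` — `a, b ∉ D` and every open `a`–`b` walk meets `D` (mine-3's `N²` without the
  condition `a ~ b`; `#Apart = t` is mine-3's `t = #{P_o = ∅}` by Lemma Φ);
* `IsoMark ω m x y` — the mark `m` is open-joined to neither `x` nor `y` (`b iso`, `a iso`);
* the six counts `T = #Apart`, `P = #{Apart ∧ b iso}`, `Q = #{Apart ∧ a iso}`,
  `Z = #{Apart ∧ IsBot}`, `Mₐ = #{b iso}`, `M_b = #{a iso}` and the three identities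
  `#N² + P + Q = T + Z` (`card_nTwo_add`), `#ac|b + T = Mₐ` (`card_cell_ac_add`),
  `#bc|a + T = M_b` (`card_cell_bc_add`) — GADGETCS Theorem 1 read on ONE graph; the flip behind
  the last two is **`card_isBot_eq_card_apart`** (Lemma Φ: `#{a, b, c pairwise apart} = #Apart`,
  by `kSwap c` / `kSwapInv c`);
* the `K_CF` facts of the six counts of a single graph (`card_apart_isBot_le_isoB`, …,
  `card_apart_isoA_le`); the missing one, `n ≤ A + B`, is (CF) itself.
-/
namespace PercRepro

open Finset

namespace MultiGraph

section ProdCFEvents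

variable {V E : Type*} (G : MultiGraph V E)

/-- **`Apart`**: the closed cluster `D = Com_c(S̄)` misses `a` and `b`, and every open `a`–`b` walk
of `S` meets `D` — mine-3's `N²` without `a ~_S b` (`#Apart = t`, the total of the `N²`-allowed
configurations, by Lemma Φ). -/
def Apart (ω : Config E) (a b c : V) : Prop :=
  ¬ G.Conn ωᶜ c a ∧ ¬ G.Conn ωᶜ c b ∧ ¬ G.ConnAvoid ω (G.cluster ωᶜ c) a b

/-- **`IsoMark`**: the mark `m` is open-joined to neither `x` nor `y` (`IsoMark ω b a c` is
«`b` iso», `IsoMark ω a b c` is «`a` iso»). -/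
def IsoMark (ω : Config E) (m x y : V) : Prop := ¬ G.Conn ω m x ∧ ¬ G.Conn ω m y

variable {G}

/-! ### Logic between the events -/

/-- `N²` is `Apart` together with `a ~ b`. -/
theorem nTwo_iff_apart {ω : Config E} {a b c : V} :
    G.NTwo ω a b c ↔ G.Apart ω a b c ∧ G.Conn ω a b := by
  unfold NTwo Apart
  tauto

/-- `a ~ b` iff neither `a` nor `b` is iso. -/
theorem conn_iff_not_isoMark {ω : Config E} {a b c : V} :
    G.Conn ω a b ↔ ¬ G.IsoMark ω b a c ∧ ¬ G.IsoMark ω a b c := by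
  unfold IsoMark
  constructor
  · intro h
    exact ⟨fun h' => h'.1 h.symm, fun h' => h'.1 h⟩
  · rintro ⟨hb, ha⟩
    by_contra hab
    have hbc : G.Conn ω b c := by
      by_contra hbc
      exact hb ⟨fun h => hab h.symm, hbc⟩
    have hac : G.Conn ω a c := by
      by_contra hac
      exact ha ⟨hab, hac⟩
    exact hab (hac.trans hbc.symm)

/-- `IsBot` is «`b` iso and `a` iso». -/
theorem isBot_iff_isoMark {ω : Config E} {a b c : V} :
    G.IsBot ω a b c ↔ G.IsoMark ω b a c ∧ G.IsoMark ω a b c := by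
  unfold IsBot IsoMark
  constructor
  · rintro ⟨hab, hac, hbc⟩
    exact ⟨⟨fun h => hab h.symm, hbc⟩, ⟨hab, hac⟩⟩
  · rintro ⟨⟨_, hbc⟩, ⟨hab, hac⟩⟩
    exact ⟨hab, hac, hbc⟩

/-- The cell `ac|b` is «`b` iso and not `IsBot`». -/
theorem cell_ac_iff {ω : Config E} {a b c : V} :
    (G.Conn ω c a ∧ ¬ G.Conn ω c b) ↔ G.IsoMark ω b a c ∧ ¬ G.IsBot ω a b c := by
  unfold IsoMark IsBot
  constructor
  · rintro ⟨hca, hcb⟩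
    refine ⟨⟨fun h => hcb (hca.trans h.symm), fun h => hcb h.symm⟩, fun h => h.2.1 hca.symm⟩
  · rintro ⟨⟨hba, hbc⟩, hbot⟩
    by_contra h
    apply hbot
    refine ⟨fun h' => hba h'.symm, fun h' => h ⟨h'.symm, fun h'' => hbc h''.symm⟩, hbc⟩

/-- The cell `bc|a` is «`a` iso and not `IsBot`». -/
theorem cell_bc_iff {ω : Config E} {a b c : V} :
    (G.Conn ω c b ∧ ¬ G.Conn ω c a) ↔ G.IsoMark ω a b c ∧ ¬ G.IsBot ω a b c := by
  unfold IsoMark IsBot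
  constructor
  · rintro ⟨hcb, hca⟩
    refine ⟨⟨fun h => hca (hcb.trans h.symm), fun h => hca h.symm⟩, fun h => h.2.2 hcb.symm⟩
  · rintro ⟨⟨hab, hac⟩, hbot⟩
    by_contra h
    apply hbot
    refine ⟨hab, hac, fun h' => h ⟨h'.symm, fun h'' => hac h''.symm⟩⟩

/-! ### Lemma Φ: `#IsBot = #Apart` -/

open Classical in
/-- **Lemma Φ for the totals**: the configurations in which the three marks are pairwise
open-disconnected are as many as the `Apart` configurations — the open-cluster flip `kSwap c`
carries the former onto the latter, the closed-cluster flip `kSwapInv c` back (mine-3's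
`t = #{P_o = ∅}`, Fact 2 of the LEANSHEET). -/
theorem card_isBot_eq_card_apart [Fintype E] (a b c : V) :
    (univ.filter fun ω : Config E => G.IsBot ω a b c).card =
      (univ.filter fun ω : Config E => G.Apart ω a b c).card := by
  refine Finset.card_nbij' (G.kSwap c) (G.kSwapInv c) ?_ ?_ ?_ ?_
  · intro τ hτ
    simp only [Finset.coe_filter, Finset.mem_univ, true_and, Set.mem_setOf_eq] at hτ ⊢
    obtain ⟨hab, hac, hbc⟩ := hτ
    refine ⟨?_, ?_, ?_⟩
    · rw [G.conn_compl_kSwap_iff]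
      exact fun h => hac h.symm
    · rw [G.conn_compl_kSwap_iff]
      exact fun h => hbc h.symm
    · intro h
      have h' := conn_kSwapInv_of_connAvoid h
      rw [kSwapInv_kSwap] at h'
      exact hab h'
  · intro ω hω
    simp only [Finset.coe_filter, Finset.mem_univ, true_and, Set.mem_setOf_eq] at hω ⊢
    obtain ⟨hca, hcb, hav⟩ := hω
    have hca' : ¬ G.Conn (G.kSwapInv c ω) c a := by
      rw [conn_kSwapInv_iff]
      exact hca
    have hcb' : ¬ G.Conn (G.kSwapInv c ω) c b := by
      rw [conn_kSwapInv_iff]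
      exact hcb
    refine ⟨fun h => ?_, fun h => hca' h.symm, fun h => hcb' h.symm⟩
    have h' := connAvoid_kSwap_of_conn hca' h
    rw [kSwap_kSwapInv] at h'
    exact hav h'
  · intro τ _
    exact kSwapInv_kSwap c τ
  · intro ω _
    exact kSwap_kSwapInv c ω

/-! ### The three identities of the six counts on one graph -/

/-- Inclusion–exclusion for a predicate `N = P ∧ ¬A ∧ ¬B` with `Bot = A ∧ B`. -/
theorem card_filter_incl_excl {α : Type*} (s : Finset α) (P A B Bot N : α → Prop)
    [DecidablePred P] [DecidablePred A] [DecidablePred B] [DecidablePred Bot] [DecidablePred N]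
    (hN : ∀ x, N x ↔ P x ∧ ¬ A x ∧ ¬ B x) (hBot : ∀ x, Bot x ↔ A x ∧ B x) :
    (s.filter N).card + (s.filter fun x => P x ∧ A x).card +
        (s.filter fun x => P x ∧ B x).card =
      (s.filter P).card + (s.filter fun x => P x ∧ Bot x).card := by
  simp only [Finset.card_filter]
  rw [← Finset.sum_add_distrib, ← Finset.sum_add_distrib, ← Finset.sum_add_distrib]
  refine Finset.sum_congr rfl fun x _ => ?_
  by_cases hP : P x <;> by_cases hA : A x <;> by_cases hB : B x <;>
    simp [hN, hBot, hP, hA, hB]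

/-- A predicate `C = A ∧ ¬Bot` with `Bot → A`: `#C + #Bot = #A`. -/
theorem card_filter_and_not_add {α : Type*} (s : Finset α) (A Bot C : α → Prop)
    [DecidablePred A] [DecidablePred Bot] [DecidablePred C] (hBA : ∀ x, Bot x → A x)
    (hC : ∀ x, C x ↔ A x ∧ ¬ Bot x) :
    (s.filter C).card + (s.filter Bot).card = (s.filter A).card := by
  simp only [Finset.card_filter]
  rw [← Finset.sum_add_distrib]
  refine Finset.sum_congr rfl fun x _ => ?_
  by_cases hB : Bot x
  · have hA : A x := hBA x hB
    simp [hC, hA, hB]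
  · by_cases hA : A x <;> simp [hC, hA, hB]

open Classical in
/-- **`#N² + P + Q = T + Z`**: `N² = Apart ∧ a ~ b`, and `a ~ b` is «neither mark iso». -/
theorem card_nTwo_add [Fintype E] (a b c : V) :
    (univ.filter fun ω : Config E => G.NTwo ω a b c).card +
        (univ.filter fun ω : Config E => G.Apart ω a b c ∧ G.IsoMark ω b a c).card +
        (univ.filter fun ω : Config E => G.Apart ω a b c ∧ G.IsoMark ω a b c).card =
      (univ.filter fun ω : Config E => G.Apart ω a b c).card +
        (univ.filter fun ω : Config E => G.Apart ω a b c ∧ G.IsBot ω a b c).card :=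
  card_filter_incl_excl univ (fun ω => G.Apart ω a b c) (fun ω => G.IsoMark ω b a c)
    (fun ω => G.IsoMark ω a b c) (fun ω => G.IsBot ω a b c) (fun ω => G.NTwo ω a b c)
    (fun ω => by rw [nTwo_iff_apart, conn_iff_not_isoMark]) (fun ω => isBot_iff_isoMark)

open Classical in
/-- **`#ac|b + T = Mₐ`**: the cell `ac|b` is «`b` iso, not `IsBot`», and `#IsBot = T` by Lemma Φ. -/
theorem card_cell_ac_add [Fintype E] (a b c : V) :
    (univ.filter fun ω : Config E => G.Conn ω c a ∧ ¬ G.Conn ω c b).card +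
        (univ.filter fun ω : Config E => G.Apart ω a b c).card =
      (univ.filter fun ω : Config E => G.IsoMark ω b a c).card := by
  rw [← card_isBot_eq_card_apart]
  exact card_filter_and_not_add univ (fun ω => G.IsoMark ω b a c) (fun ω => G.IsBot ω a b c)
    (fun ω => G.Conn ω c a ∧ ¬ G.Conn ω c b) (fun ω h => (isBot_iff_isoMark.mp h).1)
    (fun ω => cell_ac_iff)

open Classical in
/-- **`#bc|a + T = M_b`**: the cell `bc|a` is «`a` iso, not `IsBot`», and `#IsBot = T` by Lemma Φ. -/
theorem card_cell_bc_add [Fintype E] (a b c : V) :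
    (univ.filter fun ω : Config E => G.Conn ω c b ∧ ¬ G.Conn ω c a).card +
        (univ.filter fun ω : Config E => G.Apart ω a b c).card =
      (univ.filter fun ω : Config E => G.IsoMark ω a b c).card := by
  rw [← card_isBot_eq_card_apart]
  exact card_filter_and_not_add univ (fun ω => G.IsoMark ω a b c) (fun ω => G.IsBot ω a b c)
    (fun ω => G.Conn ω c b ∧ ¬ G.Conn ω c a) (fun ω h => (isBot_iff_isoMark.mp h).2)
    (fun ω => cell_bc_iff)

/-! ### The `K_CF` facts of the six counts of one graph -/

open Classical in
/-- `Z ≤ P`: `IsBot` is «`b` iso». -/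
theorem card_apart_isBot_le_isoB [Fintype E] (a b c : V) :
    (univ.filter fun ω : Config E => G.Apart ω a b c ∧ G.IsBot ω a b c).card ≤
      (univ.filter fun ω : Config E => G.Apart ω a b c ∧ G.IsoMark ω b a c).card := by
  refine Finset.card_le_card fun ω hω => ?_
  simp only [Finset.mem_filter, Finset.mem_univ, true_and] at hω ⊢
  exact ⟨hω.1, (isBot_iff_isoMark.mp hω.2).1⟩

open Classical in
/-- `Z ≤ Q`: `IsBot` is «`a` iso». -/
theorem card_apart_isBot_le_isoA [Fintype E] (a b c : V) :
    (univ.filter fun ω : Config E => G.Apart ω a b c ∧ G.IsBot ω a b c).card ≤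
      (univ.filter fun ω : Config E => G.Apart ω a b c ∧ G.IsoMark ω a b c).card := by
  refine Finset.card_le_card fun ω hω => ?_
  simp only [Finset.mem_filter, Finset.mem_univ, true_and] at hω ⊢
  exact ⟨hω.1, (isBot_iff_isoMark.mp hω.2).2⟩

open Classical in
/-- `P ≤ #ac|b + Z`: an `Apart ∧ b iso` configuration is in the cell `ac|b` unless it is `IsBot`
(`p ≤ A` of `K_CF`). -/
theorem card_apart_isoB_le [Fintype E] (a b c : V) :
    (univ.filter fun ω : Config E => G.Apart ω a b c ∧ G.IsoMark ω b a c).card ≤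
      (univ.filter fun ω : Config E => G.Conn ω c a ∧ ¬ G.Conn ω c b).card +
        (univ.filter fun ω : Config E => G.Apart ω a b c ∧ G.IsBot ω a b c).card := by
  refine le_trans (Finset.card_le_card ?_) (Finset.card_union_le _ _)
  intro ω hω
  simp only [Finset.mem_filter, Finset.mem_univ, true_and, Finset.mem_union] at hω ⊢
  by_cases hbot : G.IsBot ω a b c
  · exact Or.inr ⟨hω.1, hbot⟩
  · exact Or.inl (cell_ac_iff.mpr ⟨hω.2, hbot⟩)

open Classical in
/-- `Q ≤ #bc|a + Z` (`q ≤ B` of `K_CF`). -/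
theorem card_apart_isoA_le [Fintype E] (a b c : V) :
    (univ.filter fun ω : Config E => G.Apart ω a b c ∧ G.IsoMark ω a b c).card ≤
      (univ.filter fun ω : Config E => G.Conn ω c b ∧ ¬ G.Conn ω c a).card +
        (univ.filter fun ω : Config E => G.Apart ω a b c ∧ G.IsBot ω a b c).card := by
  refine le_trans (Finset.card_le_card ?_) (Finset.card_union_le _ _)
  intro ω hω
  simp only [Finset.mem_filter, Finset.mem_univ, true_and, Finset.mem_union] at hω ⊢
  by_cases hbot : G.IsBot ω a b c
  · exact Or.inr ⟨hω.1, hbot⟩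
  · exact Or.inl (cell_bc_iff.mpr ⟨hω.2, hbot⟩)

end ProdCFEvents

end MultiGraph

end PercRepro
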